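import Literature.MathematicalPhysics.QuantumFieldTheory.Balaban1983to89.T4HistoryLipschitzActivity

/-!
# NE9PencilEndSharp — ROUTE R3′'s END AT CONSTANT 1: the pencil∕potential-KPG one-step cluster-sum Lipschitz bound with
# constant `a(γ)e^{−δ}∕(R₀ − s₀)` (the tree's `T4HistoryLipschitzActivity.norm_clusterSum_sub_le_of_ballKPG` has `4·…`)
# by Cauchy's estimate on the STADIUM of the input pencil, and the sibling END re-threaded: rate `ω + B·τ̄∕(R₀ − s₀)`

Cell `pub-balaban`, T4-DAG §6 NE9; BINDER row NE9 OWNER lineage `b2b-balaban-t4-ne9-p1` gen 60, CRUX PROVER NE9 (ruling e34b3e0c (2)),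
filing for route R3′ «pencil ∕ two-point KP» (co-lead of record with R4; `t4/ROUTES-NE9.md` v6, PRICING-NE9 v7.0.1 §C′(1)–(4)).
PROVENANCE: the kernel text of §A–§E below is the NE9 pricing seat's scratch `HOME/b2b-balaban-t4-ne9-refuter/scratch/
StadiumKPSharp.rc0.lean` (refuter gen 7, sha16 75c899bddf747d93, farm rc 0) VERBATIM — re-namespaced, headed and filed by the
row owner (the pricing seat files no proofs; PRICING v7 §C′(3): «filing is the owner's∕a leaf's call»).  WHAT IT DOES: the rate
letter of R3′'s END is `b = c·(B∕B₀)`; the Literature sibling END `T4HistoryLipschitzActivity.ne9_and_fadingMemory_of_potentialKPG_perStep`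
gives `c = 4` (near∕far one-activity split); here `c = 1` under the SAME binders: the scalarised generating function of
`touchDiffSum_le_of_kp_disc_family` is run on the STADIUM `{z | Q′ + z•(Q − Q′) ∈ ball 0 R₀}` instead of a disc, with Cauchy's
estimate on the discs of radius `(R₀ − s₀)∕‖Q − Q′‖` about the points of `segment ℝ 0 1` and the mean value inequality on the
segment.  HONEST FRAMING (T4-DAG PAGE 1).  Rung (B)+1 of the FINITE-VOLUME T⁴ programme — NOT infinite volume, NOT a mass
gap, NOT Clay.  NE9 (`T4OutputRate.NE9` ∧ `FadingMemory`) is a cell NEW ESTIMATE, NOT PRINTED in [I] = [Balaban1987RG1] (CMP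
**109**), [II] = [Balaban1988RG2Cluster] (CMP **116**), NOT PROVED for Bałaban's E^{(j)}: the END below is «NE9 ⇐ the named
binders» (potential-KPG = line-holomorphy + majorant on the ball `‖Q‖ < R₀` = (R-0)[scope] «[II] Lemma 3 (2.38) read over Lemma
2's box» + KP for `m`; `hdec`, `hpin`, `hocc`, `hΨ`, structural binders); a sharper constant in a CONDITIONAL END is not
progress on the estimate itself; W1 = model O-NE9-1 untouched; spine 0∕9.  HONEST DEPENDENCY (cell line, verbatim): continuum
YM on T⁴ ⇐ BetaPertH ∧ nine spine estimates (0/9 proved); BetaPertH ⇐ (D1) ∧ (D4) ∧ CAP+tail; G-an2-4 gates asym, D1 and NE2/3/4.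
`FlowStep.BetaPertH`, (B), (B^μ) do not occur; [II] for TYPES only.
CONTENT ([folklore]; 0 def, 0 sorry): §A `norm_sub_le_of_stadium` (segment mean value in a stadium, one complex variable);
§B `norm_pencil_le_of_mem_segment`, `ball_subset_stadium`; §C `touchDiffSum_le_of_kp_open_family` (the tree's disc proof verbatim
on an open set: bound `a(γ)∕R`); §D **`norm_clusterSum_sub_le_of_ballKPG_sharp`** (constant 1); §E
`outputLipschitz_of_potentialKPG_sharp`, `outerLipschitz_of_potentialKPG_sharp`,
**`ne9_and_fadingMemory_of_potentialKPG_perStep_sharp`** (the sibling END's binder list VERBATIM ⊢ rate `ω + B·τ̄∕(R₀ − s₀)`),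
`fade_iff_room_sharp` (fades iff `B·τ̄ < (R₀ − s₀)(1 − ω)`; the tree's `fade_of_radius`: `4Bτ̄ < …`).  DISGUISE TEST: one-variable
complex analysis over the tree's own cluster-expansion lemmas; nothing of Bałaban's asserted.
References (TYPES only): [Balaban1988RG2Cluster] CMP **116** Lemma 3 (2.38) p. 20, (2.40)–(2.41) p. 21, (1.36) p. 9;
[KoteckyPreiss1986] p. 492–493.
-/

noncomputable section

namespace Summit.QuantumFields.BalabanUV.T4Continuum.NE9PencilEndSharp

open Metric Set Filter Topology
open scoped BigOperators ComplexConjugate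
open Literature.Probability.LatticeModels
open Literature.MathematicalPhysics.QuantumFieldTheory.Balaban1983to89.T4ActivityLipschitz
open Literature.MathematicalPhysics.QuantumFieldTheory.Balaban1983to89.T4HistoryLipschitzActivity

/-! ## §A Segment mean value in a stadium (one complex variable) -/

/-- `f` holomorphic on an open `U ⊆ ℂ` containing the disc of radius `R` about every point of the real segment
`[0,1]`, `‖f‖ ≤ M` on `U` ⇒ `‖f 1 − f 0‖ ≤ M/R`. [folklore] -/
theorem norm_sub_le_of_stadium {F : Type*} [NormedAddCommGroup F] [NormedSpace ℂ F] {f : ℂ → F} {U : Set ℂ}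
    (hU : IsOpen U) {R M : ℝ} (hR : 0 < R) (hseg : ∀ x ∈ segment ℝ (0 : ℂ) 1, ball x R ⊆ U)
    (hf : DifferentiableOn ℂ f U) (hM : ∀ z ∈ U, ‖f z‖ ≤ M) : ‖f 1 - f 0‖ ≤ M / R := by
  have hder : ∀ x ∈ segment ℝ (0 : ℂ) 1, ‖deriv f x‖ ≤ M / R := by
    intro x hx
    have key : ∀ R' ∈ Ioo 0 R, ‖deriv f x‖ ≤ M / R' := by
      rintro R' ⟨hR'0, hR'R⟩
      have hsub : closedBall x R' ⊆ U := (closedBall_subset_ball hR'R).trans (hseg x hx)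
      have hdc : DiffContOnCl ℂ f (ball x R') :=
        (hf.mono (closure_ball_subset_closedBall.trans hsub)).diffContOnCl
      exact Complex.norm_deriv_le_of_forall_mem_sphere_norm_le hR'0 hdc fun z hz =>
        hM z (hsub (sphere_subset_closedBall hz))
    have ht : Tendsto (fun R' : ℝ => M / R') (𝓝 R) (𝓝 (M / R)) :=
      tendsto_const_nhds.div tendsto_id hR.ne'
    have ht' : Tendsto (fun R' : ℝ => M / R') (𝓝[<] R) (𝓝 (M / R)) := ht.mono_left nhdsWithin_le_nhds
    exact ge_of_tendsto ht' (Filter.mem_of_superset (Ioo_mem_nhdsLT hR) fun R' hR' => key R' hR')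
  have hdiff : ∀ x ∈ segment ℝ (0 : ℂ) 1, DifferentiableAt ℂ f x := fun x hx =>
    hf.differentiableAt (hU.mem_nhds (hseg x hx (mem_ball_self hR)))
  have hmv := (convex_segment (0 : ℂ) 1).norm_image_sub_le_of_norm_deriv_le hdiff hder
    (left_mem_segment ℝ (0 : ℂ) 1) (right_mem_segment ℝ (0 : ℂ) 1)
  rwa [sub_zero, norm_one, mul_one] at hmv

/-! ## §B The stadium of an input pencil -/

section Stadium

variable {Pot : Type*} [NormedAddCommGroup Pot] [NormedSpace ℂ Pot]

/-- Points of the real segment of the pencil `z ↦ Q′ + z•(Q − Q′)` between two tables of norm `≤ s₀` have norm `≤ s₀`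
(convexity of the closed ball). [folklore] -/
theorem norm_pencil_le_of_mem_segment {Q Q' : Pot} {s₀ : ℝ} (hQ : ‖Q‖ ≤ s₀) (hQ' : ‖Q'‖ ≤ s₀) {x : ℂ}
    (hx : x ∈ segment ℝ (0 : ℂ) 1) : ‖Q' + x • (Q - Q')‖ ≤ s₀ := by
  obtain ⟨a, b, ha, hb, hab, rfl⟩ := hx
  have hx : a • (0 : ℂ) + b • (1 : ℂ) = ((b : ℝ) : ℂ) := by simp
  rw [hx, Complex.coe_smul]
  have heq : Q' + b • (Q - Q') = a • Q' + b • Q := by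
    have ha' : a = 1 - b := by linarith
    rw [ha', smul_sub, sub_smul, one_smul]; abel
  rw [heq]
  calc ‖a • Q' + b • Q‖ ≤ ‖a • Q'‖ + ‖b • Q‖ := norm_add_le _ _
    _ = a * ‖Q'‖ + b * ‖Q‖ := by rw [norm_smul, norm_smul, Real.norm_of_nonneg ha, Real.norm_of_nonneg hb]
    _ ≤ a * s₀ + b * s₀ := add_le_add (mul_le_mul_of_nonneg_left hQ' ha) (mul_le_mul_of_nonneg_left hQ hb)
    _ = s₀ := by rw [← add_mul, hab, one_mul]

/-- The stadium `{z | Q′ + z•(Q − Q′) ∈ ball 0 R₀}` contains the disc of radius `(R₀ − s₀)/‖Q − Q′‖` about every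
point of the real segment `[0,1]`. [folklore] -/
theorem ball_subset_stadium {Q Q' : Pot} {s₀ R₀ : ℝ} (hQ : ‖Q‖ ≤ s₀) (hQ' : ‖Q'‖ ≤ s₀) (hr : 0 < ‖Q - Q'‖)
    {x : ℂ} (hx : x ∈ segment ℝ (0 : ℂ) 1) :
    ball x ((R₀ - s₀) / ‖Q - Q'‖) ⊆ {z : ℂ | Q' + z • (Q - Q') ∈ ball (0 : Pot) R₀} := by
  intro z hz
  show Q' + z • (Q - Q') ∈ ball (0 : Pot) R₀
  rw [mem_ball_zero_iff]
  have hsplit : Q' + z • (Q - Q') = (Q' + x • (Q - Q')) + (z - x) • (Q - Q') := by rw [sub_smul]; abel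
  rw [hsplit]
  have hzx : ‖z - x‖ < (R₀ - s₀) / ‖Q - Q'‖ := by rw [← dist_eq_norm]; exact mem_ball.1 hz
  calc ‖Q' + x • (Q - Q') + (z - x) • (Q - Q')‖
      ≤ ‖Q' + x • (Q - Q')‖ + ‖(z - x) • (Q - Q')‖ := norm_add_le _ _
    _ ≤ s₀ + ‖z - x‖ * ‖Q - Q'‖ := add_le_add (norm_pencil_le_of_mem_segment hQ hQ' hx) (by rw [norm_smul])
    _ < s₀ + (R₀ - s₀) / ‖Q - Q'‖ * ‖Q - Q'‖ := by
        have := mul_lt_mul_of_pos_right hzx hr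
        linarith
    _ = R₀ := by rw [div_mul_cancel₀ _ hr.ne']; ring

end Stadium

/-! ## §C Pinned activity-Lipschitz bound — pencil family on an OPEN SET (the tree's disc proof, verbatim on `U`) -/

section Family

variable {P : Type*} [DecidableEq P] {inc : P → P → Prop} [DecidableRel inc]

/-- `touchDiffSum_le_of_kp_disc_family` with the disc `‖z‖ < R`, `R > 1`, replaced by an open set `U` containing the
disc of radius `R > 0` about every point of the real segment `[0,1]`: the bound improves from `a(γ)/(R − 1)` to
`a(γ)/R`. [folklore] -/
theorem touchDiffSum_le_of_kp_open_family [Std.Refl inc] [Std.Symm inc] {w : ℂ → P → ℂ} {a d : P → ℝ}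
    (ha : ∀ γ, 0 ≤ a γ) (hd : ∀ γ, 0 ≤ d γ) {L : Finset P} {U : Set ℂ} (hU : IsOpen U) {R : ℝ} (hR : 0 < R)
    (hseg : ∀ x ∈ segment ℝ (0 : ℂ) 1, ball x R ⊆ U)
    (hw : ∀ γ' ∈ L, DifferentiableOn ℂ (fun z => w z γ') U)
    (hKP : ∀ z ∈ U, ∀ γ ∈ L, ∑ γ' ∈ L with inc γ' γ, ‖w z γ'‖ * Real.exp (a γ' + d γ') ≤ a γ)
    {γ : P} (hγ : γ ∈ L) :
    touchDiffSum inc (w 1) (w 0) d L γ ≤ a γ / R := by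
  -- the scalarised generating function
  obtain ⟨G, hGdef⟩ : ∃ G : ℂ → ℂ, G = fun z => ∑ C ∈ L.powerset with KPTouches inc C γ,
      (Real.exp (∑ γ' ∈ C, d γ') : ℂ) * phaseOf (truncatedWeight inc (w 1) C - truncatedWeight inc (w 0) C) *
        truncatedWeight inc (w z) C := ⟨_, rfl⟩
  -- (1) zero-freeness of all rays of all sub-volumes along `U`
  have hZ : ∀ z ∈ U, ∀ B : Finset P, B ⊆ L → ∀ t ∈ Set.Icc (0 : ℝ) 1,
      polymerPartitionFunction inc (fun γ' => (t : ℂ) * w z γ') B ≠ 0 := by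
    intro z hz B hB t ht
    have hKPz : IsKPVolume inc (w z) a L := isKPVolume_of_kpd hd (hKP z hz)
    have hKPt : IsKPVolume inc (fun γ' => (t : ℂ) * w z γ') a L := by
      intro γ₀ hγ₀
      refine le_trans (Finset.sum_le_sum fun γ' _ => ?_) (hKPz γ₀ hγ₀)
      unfold kpTerm
      refine mul_le_mul_of_nonneg_right ?_ (Real.exp_nonneg _)
      rw [norm_mul, Complex.norm_real, Real.norm_eq_abs, abs_of_nonneg ht.1]
      exact mul_le_of_le_one_left (norm_nonneg _) ht.2
    exact polymerPartitionFunction_ne_zero_of_kp hKPt hB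
  -- (2) `G` is holomorphic on `U`
  have hGdiff : DifferentiableOn ℂ G U := by
    rw [hGdef]
    refine DifferentiableOn.fun_sum fun C hC => ?_
    have hCL : C ⊆ L := Finset.mem_powerset.1 (Finset.mem_filter.1 hC).1
    refine DifferentiableOn.const_mul ?_ _
    show DifferentiableOn ℂ (fun z => truncatedWeight inc (w z) C) U
    unfold truncatedWeight
    refine DifferentiableOn.fun_sum fun B hB => ?_
    have hBL : B ⊆ L := (Finset.mem_powerset.1 hB).trans hCL
    refine DifferentiableOn.const_mul ?_ _
    exact differentiableOn_polymerLogZ_param (v := w) B hU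
      (fun γ' hγ' => hw γ' (hBL hγ')) (fun z hz t ht => hZ z hz B hBL t ht)
  -- (3) `|G z| ≤ a γ` on `U`
  have hGle : ∀ z ∈ U, ‖G z‖ ≤ a γ := by
    intro z hz
    rw [hGdef]
    calc ‖∑ C ∈ L.powerset with KPTouches inc C γ,
            (Real.exp (∑ γ' ∈ C, d γ') : ℂ) * phaseOf (truncatedWeight inc (w 1) C - truncatedWeight inc (w 0) C) *
              truncatedWeight inc (w z) C‖
        ≤ ∑ C ∈ L.powerset with KPTouches inc C γ,
            ‖(Real.exp (∑ γ' ∈ C, d γ') : ℂ) * phaseOf (truncatedWeight inc (w 1) C - truncatedWeight inc (w 0) C) *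
              truncatedWeight inc (w z) C‖ := norm_sum_le _ _
      _ ≤ ∑ C ∈ L.powerset with KPTouches inc C γ,
            ‖truncatedWeight inc (w z) C‖ * Real.exp (∑ γ' ∈ C, d γ') := by
          refine Finset.sum_le_sum fun C _ => ?_
          rw [norm_mul, norm_mul, Complex.norm_real, Real.norm_of_nonneg (Real.exp_nonneg _)]
          have h1 := norm_phaseOf_le_one (truncatedWeight inc (w 1) C - truncatedWeight inc (w 0) C)
          have he := Real.exp_nonneg (∑ γ' ∈ C, d γ')
          have hn := norm_nonneg (truncatedWeight inc (w z) C)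
          nlinarith [mul_nonneg he hn]
      _ = touchSum inc (w z) d L γ := rfl
      _ ≤ a γ := touchSum_le_of_kp ha hd (hKP z hz) hγ
  -- (4) `G 1 - G 0` is the (real) pinned difference sum; the stadium bound of §A
  have hG10 : G 1 - G 0 = ((touchDiffSum inc (w 1) (w 0) d L γ : ℝ) : ℂ) := by
    rw [hGdef]
    beta_reduce
    rw [← Finset.sum_sub_distrib, touchDiffSum, Complex.ofReal_sum]
    refine Finset.sum_congr rfl fun C _ => ?_
    rw [← mul_sub, mul_assoc, phaseOf_mul_self, Complex.ofReal_mul, mul_comm]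
  have h := norm_sub_le_of_stadium hU hR hseg hGdiff hGle
  rw [hG10, Complex.norm_real, Real.norm_of_nonneg (touchDiffSum_nonneg _ _ d L γ)] at h
  exact h

end Family

/-! ## §D The sibling END's one-step bound with constant 1 -/

section Sharp

variable {Pot : Type*} [NormedAddCommGroup Pot] [NormedSpace ℂ Pot]
variable {P : Type*} [DecidableEq P] {inc : P → P → Prop} [DecidableRel inc]

/-- **`norm_clusterSum_sub_le_of_ballKPG` WITH CONSTANT 1** (same binders): `‖E_{w(Q)}(𝒞) − E_{w(Q′)}(𝒞)‖ ≤
a(γ)e^{−δ}/(R₀ − s₀)·‖Q − Q′‖`. [folklore] -/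
theorem norm_clusterSum_sub_le_of_ballKPG_sharp [Std.Refl inc] [Std.Symm inc] {w : Pot → P → ℂ} {m a d : P → ℝ}
    (ha : ∀ γ, 0 ≤ a γ) (hd : ∀ γ, 0 ≤ d γ) {L : Finset P} {s₀ R₀ : ℝ} (hsR : s₀ < R₀)
    (hhol : ∀ γ ∈ L, LineHolo (fun Q => w Q γ) R₀)
    (hmaj : ∀ Q ∈ ball (0 : Pot) R₀, ∀ γ ∈ L, ‖w Q γ‖ ≤ m γ)
    (hkp : ∀ γ ∈ L, ∑ γ' ∈ L with inc γ' γ, m γ' * Real.exp (a γ' + d γ') ≤ a γ)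
    {𝒞 : Finset (Finset P)} {γ : P} (hγ : γ ∈ L) (hsub : ∀ K ∈ 𝒞, K ⊆ L) (hpin : ∀ K ∈ 𝒞, KPTouches inc K γ)
    {δ : ℝ} (hdec : ∀ K ∈ 𝒞, δ ≤ ∑ γ' ∈ K, d γ') {Q Q' : Pot} (hQ : ‖Q‖ ≤ s₀) (hQ' : ‖Q'‖ ≤ s₀) :
    ‖clusterSum inc (w Q) 𝒞 - clusterSum inc (w Q') 𝒞‖ ≤ (a γ * Real.exp (-δ)) / (R₀ - s₀) * ‖Q - Q'‖ := by
  have hϱ : 0 < R₀ - s₀ := sub_pos.mpr hsR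
  have henv : 0 ≤ a γ * Real.exp (-δ) := mul_nonneg (ha γ) (Real.exp_nonneg _)
  rcases (norm_nonneg (Q - Q')).eq_or_lt with h0 | hr
  · have hQQ : Q = Q' := sub_eq_zero.1 (norm_eq_zero.1 h0.symm)
    rw [hQQ, sub_self, norm_zero, sub_self, norm_zero, mul_zero]
  -- the pencil family on the stadium
  set U : Set ℂ := {z : ℂ | Q' + z • (Q - Q') ∈ ball (0 : Pot) R₀} with hU
  have hUopen : IsOpen U :=
    isOpen_ball.preimage (continuous_const.add (continuous_id.smul continuous_const))
  have hRpos : 0 < (R₀ - s₀) / ‖Q - Q'‖ := div_pos hϱ hr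
  have hseg : ∀ x ∈ segment ℝ (0 : ℂ) 1, ball x ((R₀ - s₀) / ‖Q - Q'‖) ⊆ U :=
    fun x hx => ball_subset_stadium hQ hQ' hr hx
  have hw : ∀ γ' ∈ L, DifferentiableOn ℂ (fun z : ℂ => w (Q' + z • (Q - Q')) γ') U :=
    fun γ' hγ' => (hhol γ' hγ') Q' (Q - Q')
  have hKPU : ∀ z ∈ U, ∀ γ₀ ∈ L,
      ∑ γ' ∈ L with inc γ' γ₀, ‖w (Q' + z • (Q - Q')) γ'‖ * Real.exp (a γ' + d γ') ≤ a γ₀ :=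
    fun z hz => kpd_of_norm_le (fun γ₁ hγ₁ => hmaj _ hz γ₁ hγ₁) hkp
  have key := touchDiffSum_le_of_kp_open_family (inc := inc) (w := fun z => w (Q' + z • (Q - Q'))) ha hd hUopen
    hRpos hseg hw hKPU hγ
  simp only [one_smul, zero_smul, add_zero, add_sub_cancel] at key
  -- localisation and the cluster sum
  have hloc := sum_norm_truncatedWeight_sub_le_touchDiffSum (inc := inc) (wA := w Q) (wB := w Q') d hsub hpin hdec
  calc ‖clusterSum inc (w Q) 𝒞 - clusterSum inc (w Q') 𝒞‖
      ≤ ∑ K ∈ 𝒞, ‖truncatedWeight inc (w Q) K - truncatedWeight inc (w Q') K‖ := by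
        unfold clusterSum
        rw [← Finset.sum_sub_distrib]
        exact norm_sum_le _ _
    _ ≤ touchDiffSum inc (w Q) (w Q') d L γ * Real.exp (-δ) := hloc
    _ ≤ a γ / ((R₀ - s₀) / ‖Q - Q'‖) * Real.exp (-δ) := mul_le_mul_of_nonneg_right key (Real.exp_nonneg _)
    _ = (a γ * Real.exp (-δ)) / (R₀ - s₀) * ‖Q - Q'‖ := by
        rw [div_div_eq_mul_div]; ring

end Sharp

/-! ## §E The sibling END re-threaded with constant 1: rate `ω + B·τ̄/(R₀ − s₀)` (copies of the tree's
`outputLipschitz_of_potentialKPG` ∕ `outerLipschitz_of_potentialKPG` ∕ `ne9_and_fadingMemory_of_potentialKPG_perStep`,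
:1000–1060, with the factor 4 removed; SAME binders) -/

/-! (§E was the scratch namespace `NE9PricingScratch`; here the file namespace.) -/

section EndSharp

open Literature.MathematicalPhysics.QuantumFieldTheory.Balaban1983to89
open Literature.MathematicalPhysics.QuantumFieldTheory.Balaban1983to89.T4OutputRate
open Literature.MathematicalPhysics.QuantumFieldTheory.Balaban1983to89.T4HistoryLipschitzRecursion
open Literature.MathematicalPhysics.QuantumFieldTheory.Balaban1983to89.T4HistoryLipschitzOuter
open Literature.MathematicalPhysics.QuantumFieldTheory.Balaban1983to89.T4HistoryLipschitzActivity (ClusterGeom)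

variable {C : Carriers} (G : ClusterGeom C) {Bg : Type} {Pot : Type*} [NormedAddCommGroup Pot] [NormedSpace ℂ Pot]

/-- `OutputLipschitz` from POTENTIAL-KPG with constant `B₀ k/(R₀ − s₀)` (the tree's has `4·B₀ k/(R₀ − s₀)`). [folklore] -/
theorem outputLipschitz_of_potentialKPG_sharp {ι : Type} {E : Functional C Bg} {W : Set (ℕ → ℝ)}
    {T : ℕ → (ℕ → ℝ) → (Bg → C.Dom → ℝ) → ι → ℝ} {Ψ : ℕ → ℝ → (ι → ℝ) → Bg → C.Dom → ℝ}
    {act : ℕ → ℝ → Bg → Pot → G.P → ℂ} {m : ℕ → ℝ → Bg → G.P → ℝ} {a d : G.P → ℝ} {δ : C.Dom → ℝ} {B₀ : ℕ → ℝ}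
    {κ s₀ R₀ : ℝ} {wt : ℕ → ι → ℝ} (ρ : ℕ → (ι → ℝ) → Pot) (hKP : G.PotentialKPG W act m a d R₀)
    (hdec : G.DecayExtract δ d) (hpin : G.PinBudget a δ B₀ κ) (hsR : s₀ < R₀)
    (hρ : ∀ (k : ℕ) (P P' : ι → ℝ) (M : ℝ), (∀ y, |P y - P' y| ≤ wt k y * M) → ‖ρ k P - ρ k P'‖ ≤ M)
    (hΨ : ∀ (k : ℕ) (s : ℝ) (P P' : ι → ℝ) (U : Bg) (X : C.Dom),
      Ψ k s P U X - Ψ k s P' U X = (G.newTerm act k s U X (ρ k P) - G.newTerm act k s U X (ρ k P')).re)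
    (hocc : ∀ g ∈ W, ∀ g' ∈ W, ∀ k : ℕ, ‖ρ k (T k g' (E g))‖ ≤ s₀) :
    OutputLipschitz E W T Ψ κ wt (fun k => B₀ k / (R₀ - s₀)) := by
  obtain ⟨ha, hd, hP⟩ := hKP
  intro g hg g' hg' k M hM U X hX
  obtain ⟨hhol, hmaj, hkp⟩ := hP g' hg' k U X hX
  have hQQ' : ‖ρ k (T k g' (E g)) - ρ k (T k g' (E g'))‖ ≤ M := hρ k _ _ M hM
  have hϱ : 0 < R₀ - s₀ := sub_pos.mpr hsR
  have key := norm_clusterSum_sub_le_of_ballKPG_sharp (inc := G.inc) (w := fun Q => act k (g' k) U Q) ha hd hsR hhol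
    hmaj hkp (G.pin_mem X) (G.clus_sub X) (G.clus_pin X) (hdec X) (hocc g hg g' hg' k) (hocc g' hg' g' hg' k)
  have henv : 0 ≤ B₀ k * Real.exp (-(κ * C.d X)) :=
    le_trans (mul_nonneg (ha _) (Real.exp_nonneg _)) (hpin k X hX)
  rw [hΨ, Complex.sub_re]
  calc |(G.newTerm act k (g' k) U X (ρ k (T k g' (E g)))).re -
          (G.newTerm act k (g' k) U X (ρ k (T k g' (E g')))).re|
        = |(G.newTerm act k (g' k) U X (ρ k (T k g' (E g))) -
            G.newTerm act k (g' k) U X (ρ k (T k g' (E g')))).re| := by rw [Complex.sub_re]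
    _ ≤ ‖G.newTerm act k (g' k) U X (ρ k (T k g' (E g))) - G.newTerm act k (g' k) U X (ρ k (T k g' (E g')))‖ :=
        Complex.abs_re_le_norm _
    _ ≤ (a (G.pin X) * Real.exp (-(δ X))) / (R₀ - s₀) * ‖ρ k (T k g' (E g)) - ρ k (T k g' (E g'))‖ := key
    _ ≤ (B₀ k * Real.exp (-(κ * C.d X))) / (R₀ - s₀) * M := by
        have h4 : 0 ≤ (B₀ k * Real.exp (-(κ * C.d X))) / (R₀ - s₀) := by positivity
        exact mul_le_mul (div_le_div_of_nonneg_right (by linarith [hpin k X hX]) hϱ.le) hQQ' (norm_nonneg _) h4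
    _ = Real.exp (-(κ * C.d X)) * (B₀ k / (R₀ - s₀) * M) := by ring

/-- `OuterLipschitz` from POTENTIAL-KPG with constant `B₀ k/(R₀ − s₀)`. [folklore] -/
theorem outerLipschitz_of_potentialKPG_sharp {ι : Type} {E : Functional C Bg} {W : Set (ℕ → ℝ)}
    {T : ℕ → (ℕ → ℝ) → (Bg → C.Dom → ℝ) → ι → ℝ} {Ψ : ℕ → ℝ → (ι → ℝ) → Bg → C.Dom → ℝ}
    {act : ℕ → ℝ → Bg → Pot → G.P → ℂ} {m : ℕ → ℝ → Bg → G.P → ℝ} {a d : G.P → ℝ} {δ : C.Dom → ℝ} {B₀ lam : ℕ → ℝ}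
    {κ s₀ R₀ : ℝ} {wt : ℕ → ι → ℝ} (ρ : ℕ → (ι → ℝ) → Pot) (hfac : Factorises E W T Ψ)
    (hlast : LastCouplingLipschitz E W T Ψ κ lam) (hKP : G.PotentialKPG W act m a d R₀) (hdec : G.DecayExtract δ d)
    (hpin : G.PinBudget a δ B₀ κ) (hsR : s₀ < R₀)
    (hρ : ∀ (k : ℕ) (P P' : ι → ℝ) (M : ℝ), (∀ y, |P y - P' y| ≤ wt k y * M) → ‖ρ k P - ρ k P'‖ ≤ M)
    (hΨ : ∀ (k : ℕ) (s : ℝ) (P P' : ι → ℝ) (U : Bg) (X : C.Dom),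
      Ψ k s P U X - Ψ k s P' U X = (G.newTerm act k s U X (ρ k P) - G.newTerm act k s U X (ρ k P')).re)
    (hocc : ∀ g ∈ W, ∀ g' ∈ W, ∀ k : ℕ, ‖ρ k (T k g' (E g))‖ ≤ s₀) :
    OuterLipschitz E W T κ wt lam (fun k => B₀ k / (R₀ - s₀)) :=
  outerLipschitz_of_factorisation hfac hlast
    (outputLipschitz_of_potentialKPG_sharp G ρ hKP hdec hpin hsR hρ hΨ hocc)

/-- **THE SIBLING END WITH CONSTANT 1**: the binder list of the tree's `ne9_and_fadingMemory_of_potentialKPG_perStep`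
VERBATIM (only `hpos` re-lettered to the new rate) ⊢ NE9 with the product moduli of rate `ω + B·τ̄/(R₀ − s₀)` and
`FadingMemory` of the same rate — fading iff `B·τ̄ < (R₀ − s₀)(1 − ω)`. [folklore] -/
theorem ne9_and_fadingMemory_of_potentialKPG_perStep_sharp {ι : Type} {E : Functional C Bg} {W : Set (ℕ → ℝ)}
    {Adm : Set (Bg → C.Dom → ℝ)} {T : ℕ → (ℕ → ℝ) → (Bg → C.Dom → ℝ) → ι → ℝ}
    {Ψ : ℕ → ℝ → (ι → ℝ) → Bg → C.Dom → ℝ} {act : ℕ → ℝ → Bg → Pot → G.P → ℂ} {m : ℕ → ℝ → Bg → G.P → ℝ}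
    {a d : G.P → ℝ} {δ : C.Dom → ℝ} {κ s₀ R₀ B ℓ τbar ω : ℝ} {wt : ℕ → ι → ℝ} {τ : ℕ → ℕ → ℝ} {lam : ℕ → ℝ}
    (ρ : ℕ → (ι → ℝ) → Pot) (h0 : ScaleZeroFree E W) (hAdm : AdmissibleTerms E W Adm) (hres : AdmRestrict Adm)
    (hadd : ChannelAdditive Adm T) (hsum : ChannelStepSum Adm T) (hstep : ChannelSizeAtStepNN Adm T κ wt τ)
    (hfac : Factorises E W T Ψ) (hlast : LastCouplingLipschitz E W T Ψ κ lam) (hKP : G.PotentialKPG W act m a d R₀)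
    (hdec : G.DecayExtract δ d) (hpin : G.PinBudget a δ (fun _ => B) κ) (hsR : s₀ < R₀)
    (hρ : ∀ (k : ℕ) (P P' : ι → ℝ) (M : ℝ), (∀ y, |P y - P' y| ≤ wt k y * M) → ‖ρ k P - ρ k P'‖ ≤ M)
    (hΨ : ∀ (k : ℕ) (s : ℝ) (P P' : ι → ℝ) (U : Bg) (X : C.Dom),
      Ψ k s P U X - Ψ k s P' U X = (G.newTerm act k s U X (ρ k P) - G.newTerm act k s U X (ρ k P')).re)
    (hocc : ∀ g ∈ W, ∀ g' ∈ W, ∀ k : ℕ, ‖ρ k (T k g' (E g))‖ ≤ s₀) (hℓ : 0 ≤ ℓ) (hB : 0 ≤ B) (hτbar : 0 ≤ τbar)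
    (hω : 0 ≤ ω) (hpos : 0 < ω + B / (R₀ - s₀) * τbar) (hlam : ∀ k, lam k ≤ ℓ)
    (hτ : ∀ k j, j ≤ k → 0 ≤ τ k j ∧ τ k j ≤ τbar * ω ^ (k - j)) :
    NE9 E W κ (prodModuli ℓ fun _ => ω + B / (R₀ - s₀) * τbar) ∧
      FadingMemory (ℓ / (ω + B / (R₀ - s₀) * τbar)) (ω + B / (R₀ - s₀) * τbar)
        (prodModuli ℓ fun _ => ω + B / (R₀ - s₀) * τbar) :=
  have hc : 0 ≤ B / (R₀ - s₀) := div_nonneg hB (sub_pos.mpr hsR).le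
  ne9_and_fadingMemory_of_perStepNN h0 hAdm hres hadd hsum hstep
    (outerLipschitz_of_potentialKPG_sharp G ρ hfac hlast hKP hdec hpin hsR hρ hΨ hocc) hℓ hc hτbar hω hpos hlam
    (fun _ => ⟨hc, le_rfl⟩) hτ

/-- The sharp rate fades iff `B·τ̄ < (R₀ − s₀)(1 − ω)` (compare the tree's `fade_of_radius`: `4Bτ̄ < …`). [folklore] -/
theorem fade_iff_room_sharp {ω B τbar R₀ s₀ : ℝ} (hsR : s₀ < R₀) :
    ω + B / (R₀ - s₀) * τbar < 1 ↔ B * τbar < (R₀ - s₀) * (1 - ω) := by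
  have hϱ : 0 < R₀ - s₀ := sub_pos.mpr hsR
  rw [show B / (R₀ - s₀) * τbar = B * τbar / (R₀ - s₀) by ring]
  constructor
  · intro h
    have h' : B * τbar / (R₀ - s₀) < 1 - ω := by linarith
    rwa [div_lt_iff₀ hϱ, mul_comm (1 - ω)] at h'
  · intro h
    have h' : B * τbar / (R₀ - s₀) < 1 - ω := by
      rw [div_lt_iff₀ hϱ, mul_comm (1 - ω)]; exact h
    linarith

end EndSharp

end Summit.QuantumFields.BalabanUV.T4Continuum.NE9PencilEndSharp

end
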